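import Summits.QuantumFields.BalabanUV.Beta.D1BFx.NeedleGhostBubbleRowMass10

/-!
# `BalabanUV.Beta.D1BFx.NeedleGhostBubbleRowMass10T5` — road «BF-x» for binder row D1, slot (K), END row `hGrp gN`, (N-2) row «NT-5» WITH TOLERANCE `n¹⁰`
# (cell T₅-ii of `END-ii-SPEC.md` v1.1 §3 (c), owner ruling ρ-g11-11 (4)(c); an3-g65 census S-an3-g65-1): **THE MIRROR GHOST NEEDLE BUBBLE ROW `h₅`
# (`qA ⊗ ghCur` over the scalar ghost legs — the rooted needle at the DISPLACED bond `b + w`, the current at the base `b`) FROM THE SCALING LETTER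
# `|ωgh n·(cQ n·cK n)| ≤ k·n¹⁰`** — FILE W's `abs_T₅_le_needle_env` summed in the (1.22) variable block by block with M7 at a fixed site (gen-15's running-bond
# pattern `NeedleNdlDipRow.abs_fullSum_le_of_needle_envelope`, here for the rooted jet `qJetAt ρ n`), then the trivial base-point average

HONEST DEPENDENCY (cell records, verbatim): «continuum YM on T⁴ ⇐ BetaPertH ∧ nine spine estimates (0/9 proved); BetaPertH ⇐ (D1) ∧ (D4) ∧
CAP+tail; G-an2-4 gates asym, D1 and NE2/3/4.»  HONEST FRAMING (cell contract, verbatim): «discharging `BetaPertH` makes Bałaban's UV stability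
UNCONDITIONAL — a real constructive-QFT result; it is NOT the continuum limit and NOT the Clay problem.»  THIS MODULE DISCHARGES NOTHING of the wall:
[folklore] lattice bookkeeping BY NAME over FILE W `NeedleGhostDipoleWord` (pointwise envelope), FILE R `NeedleGhostBubbleRowMass10` (`env_nonneg`, `moment_env_le`),
gan24-leaf-05's rooted bond marginal M7 `NeedleBondMarginal.sum_bond_abs_qJetAt_le_of_root` (root `ctrHalf n` in range: `ctrHalf_mem`), the block geometry
`B6QGQLower276.subset_U_image ∕ sum_U`, `GluonNdlLocalRow.abs_weight_le_of_same_block`, `NeedleProjProjRow.sum_resSite_avg_le`, `LatticeHLSPairing.abs_fullSum_le_of_abs_sum_le`.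
No `def`, no `def … : Prop`, nothing cited, 0 sorry.  THE SCALING LETTER `|ωgh n·(cQ n·cK n)| ≤ k·n¹⁰` IS A DISPLAYED HYPOTHESIS on ARBITRARY weight sequences;
nothing about Bałaban's operators is asserted.  END-AGNOSTIC: no `hω`, no `s`, no END-ii name (READING NOTE as in FILE R: letter `4N²a·n⁶` under reading (i),
`4N²a·n¹⁰` under (ii) ∕ ENDₛ at `s n = n⁻²`).  Root-level binders hW ∕ hR-sockets ∕ hSX-socket ∕ D1Tel ∕ D1Rep — 0 discharged; (K) NOT closed; NOT D1,
NOT `BetaPertH`, NOT continuum, NOT Clay.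

ABSOLUTE RULE (cell charter, verbatim): «No internally-minted statement may enter as a cited fact. Every hypothesis is either kernel-proved in this
package or a verbatim quotation of a PUBLISHED theorem with page reference. The manuscript(s) under audit are NOT citable for their own disputed
steps — they are the thing under adjudication; programme-internal (2001/route/tribunal) claims are never citable.»

LEDGER: per base bond `b`, `|n⁻⁸·fullSum_b| ≤ n⁻⁸·((n−1)·n⁻⁴)·Mg(n)` (the running needle's roots summed by M7 at each site of each block: `≤ (n−1)·n⁻⁴`;
the sites against the envelope's centred moment `Mg(n) = O(n)`); base average trivial; total `O(n⁻¹⁰)` against the letter `k·n¹⁰`.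
CONTENT (all [folklore]):
* §1 `abs_fullSum_le_of_running_needle_envelope` — the (1.22) sum at one base site from a needle-site envelope rooted AT THE RUNNING BOND `b + w`, for the
  rooted jet `qJetAt ρ n` with the root in range (gen-15's `qJet` lemma verbatim with M7's rooted form).
* §2 **`abs_fullSum_T₅_le₁₀`**, **`abs_row₅_le₁₀`**.
* §3 **`h₅_of_scaling₁₀ (ha) (hk : ∀ n ≥ 2, |ωgh n·(cQ n·cK n)| ≤ k·n¹⁰) ⊢ h₅`** VERBATIM (`NeedleRowGlue.abs_gN_row_le_of_tables`'s row; = `NeedleGhostBubbleRowClosed.h₅_of_scaling`'s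
  conclusion with tolerance `n¹⁰` for `n⁶`), the same n-free `C₄(a)` as FILE R.
Unit `b2b-balaban-beta-d1-formalise-leaf-01` (gen 16), D1 formalisation swarm LEAF PROVER 01; `LEAVES-BFx.md` row (N) ∕ (N-2) «NT-5», cell T₅-ii.
-/

noncomputable section

namespace Summit.QuantumFields.BalabanUV.Beta.D1BFx.NeedleGhostBubbleRowMass10T5

open Finset Real
open scoped BigOperators
open Literature.MathematicalPhysics.QuantumFieldTheory.Balaban1983to89
open Literature.MathematicalPhysics.QuantumFieldTheory.Balaban1983to89.Beta
open B6QGQLower276 (blk B mem_B U sum_U subset_U_image)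
open Beta.PoissonInterior (nrm one_le_nrm nrm_pos nrm_neg)
open DyadicShell (Pt toReal supNorm)
open ExpKernelCalculus (Site MKer)
open WindowIdentification (fullSum)
open DressedMomentNormalisation (resSite)
open GhostStencil (ghCur)
open Summit.QuantumFields.BalabanUV.Beta.D1BFx.FineHessianSectors (biBubbleTable)
open Summit.QuantumFields.BalabanUV.Beta.D1BFx.GhostStencilRooted (qJetAt qAntiAt)
open Summit.QuantumFields.BalabanUV.Beta.D1BFx.GhostStencilRootedReflection (ctrHalf ctrHalf_mem)
open Summit.QuantumFields.BalabanUV.Beta.D1BFx.GhostLeg (Ggh)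
open Summit.QuantumFields.BalabanUV.Beta.D1BFx.PointColumnSplit (cG0 cG0_nonneg cSplit cSplit_nonneg)
open Summit.QuantumFields.BalabanUV.Beta.D1BFx.GhostLegFree (ghA0 ghA1 ghDelta ghDelta_pos)
open Summit.QuantumFields.BalabanUV.Beta.D1BFx.GhostLegBlockMass (cNear ghA0_pos)
open Summit.QuantumFields.BalabanUV.Beta.D1BFx.GhostLegBlockMassD1 (cNear1 ghA1_nonneg)
open Summit.QuantumFields.BalabanUV.Beta.D1BFx.RColumnBlockMass (cNear_nonneg cNear1_nonneg)
open Summit.QuantumFields.BalabanUV.Beta.D1BFx.NeedleGhostDipoleWord (abs_T₅_le_needle_env)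
open Summit.QuantumFields.BalabanUV.Beta.D1BFx.NeedleGhostBubbleRowMass10 (env_nonneg moment_env_le)
open Summit.QuantumFields.BalabanUV.Beta.D1BFx.NeedleProjProjRow (sum_resSite_avg_le)
open Summit.QuantumFields.BalabanUV.Beta.D1BFx.LatticeHLSPairing (abs_fullSum_le_of_abs_sum_le)
open Summit.QuantumFields.BalabanUV.Beta.D1BFx.GluonNdlLocalRow (abs_weight_le_of_same_block)

variable (n : ℕ) [NeZero n] {a : ℝ}

/-! ## §1 The (1.22) sum at one base site from a needle-site envelope rooted at the running bond -/

/-- [folklore] **THE (1.22) SUM FROM A NEEDLE-SITE ENVELOPE AT THE RUNNING BOND, ROOTED JET** (root `ρ` in range): if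
`|T w| ≤ Σ_{s∈B(blk(b+w))} |qJetAt ρ n κ (b+w) (blk(b+w)) s|·g(s)` with `g ≥ 0` and `Σ_{s∈S}(2‖b−s‖²+2n²)·g(s) ≤ Mg` for every finite `S`, then
`|fullSum (w ↦ w_μw_ν·T w)| ≤ (n−1)n⁻⁴·Mg` (gen-15's `NeedleNdlDipRow.abs_fullSum_le_of_needle_envelope` with M7 in its rooted form
`NeedleBondMarginal.sum_bond_abs_qJetAt_le_of_root`). -/
theorem abs_fullSum_le_of_running_needle_envelope {ρ : Site 4} (hρ : ∀ i : Fin 4, 0 ≤ ρ i ∧ ρ i < n) {T g : Pt → ℝ} {Mg : ℝ}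
    (κ : Fin 4) (b : Pt) (hg0 : ∀ s, 0 ≤ g s)
    (hT : ∀ w : Pt, |T w| ≤ ∑ s ∈ B (n - 1) (blk (n - 1) (b + w)), |qJetAt ρ n κ (b + w) (blk (n - 1) (b + w)) s| * g s)
    (hmom : ∀ S : Finset Pt, ∑ s ∈ S, (2 * (PoissonInterior.supNorm (d := 4) (b - s) : ℝ) ^ 2 + 2 * (n : ℝ) ^ 2) * g s ≤ Mg) (μ ν : Fin 4) :
    |fullSum (fun w : Pt => toReal w μ * toReal w ν * T w)| ≤ (((n : ℝ) - 1) * ((n : ℝ) ^ 4)⁻¹) * Mg := by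
  classical
  have hn1 : (1 : ℝ) ≤ n := by exact_mod_cast NeZero.one_le
  set m : ℕ := n - 1 with hm
  set h : Pt → ℝ := fun u => |toReal (u - b) μ * toReal (u - b) ν| * ∑ s ∈ B m (blk m u), |qJetAt ρ n κ u (blk m u) s| * g s with hh
  have hh0 : ∀ u, 0 ≤ h u := fun u => mul_nonneg (abs_nonneg _) (Finset.sum_nonneg fun s _ => mul_nonneg (abs_nonneg _) (hg0 s))
  have hdom : ∀ w : Pt, |toReal w μ * toReal w ν * T w| ≤ h (b + w) := by
    intro w
    rw [abs_mul, hh]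
    simp only [add_sub_cancel_left]
    exact mul_le_mul_of_nonneg_left (hT w) (abs_nonneg _)
  have hblock : ∀ β : Pt, ∑ u ∈ B m β, h u ≤ (((n : ℝ) - 1) * ((n : ℝ) ^ 4)⁻¹) *
      ∑ s ∈ B m β, (2 * (PoissonInterior.supNorm (d := 4) (b - s) : ℝ) ^ 2 + 2 * (n : ℝ) ^ 2) * g s := by
    intro β
    calc ∑ u ∈ B m β, h u = ∑ u ∈ B m β, ∑ s ∈ B m β, |toReal (u - b) μ * toReal (u - b) ν| * (|qJetAt ρ n κ u β s| * g s) := by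
          refine Finset.sum_congr rfl fun u hu => ?_
          rw [hh]; simp only [mem_B.1 hu, Finset.mul_sum]
      _ = ∑ s ∈ B m β, ∑ u ∈ B m β, |toReal (u - b) μ * toReal (u - b) ν| * (|qJetAt ρ n κ u β s| * g s) := Finset.sum_comm
      _ ≤ ∑ s ∈ B m β, ∑ u ∈ B m β, (2 * (PoissonInterior.supNorm (d := 4) (b - s) : ℝ) ^ 2 + 2 * (n : ℝ) ^ 2) * (|qJetAt ρ n κ u β s| * g s) :=
          Finset.sum_le_sum fun s hs => Finset.sum_le_sum fun u hu =>
            mul_le_mul_of_nonneg_right (abs_weight_le_of_same_block β u s b hu hs μ ν) (mul_nonneg (abs_nonneg _) (hg0 s))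
      _ = ∑ s ∈ B m β, (2 * (PoissonInterior.supNorm (d := 4) (b - s) : ℝ) ^ 2 + 2 * (n : ℝ) ^ 2) * g s * ∑ u ∈ B m β, |qJetAt ρ n κ u β s| := by
          refine Finset.sum_congr rfl fun s _ => ?_
          rw [Finset.mul_sum]; exact Finset.sum_congr rfl fun u _ => by ring
      _ ≤ ∑ s ∈ B m β, (2 * (PoissonInterior.supNorm (d := 4) (b - s) : ℝ) ^ 2 + 2 * (n : ℝ) ^ 2) * g s * (((n : ℝ) - 1) * ((n : ℝ) ^ 4)⁻¹) :=
          Finset.sum_le_sum fun s _ => mul_le_mul_of_nonneg_left (NeedleBondMarginal.sum_bond_abs_qJetAt_le_of_root n κ hρ _ β s)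
            (mul_nonneg (by positivity) (hg0 s))
      _ = _ := by rw [Finset.mul_sum]; exact Finset.sum_congr rfl fun s _ => by ring
  have hfin : ∀ S : Finset Pt, ∑ w ∈ S, |toReal w μ * toReal w ν * T w| ≤ (((n : ℝ) - 1) * ((n : ℝ) ^ 4)⁻¹) * Mg := by
    intro S
    set S' : Finset Pt := S.map (addLeftEmbedding b) with hS'
    have hmn : 0 ≤ ((n : ℝ) - 1) * ((n : ℝ) ^ 4)⁻¹ := mul_nonneg (sub_nonneg.2 hn1) (by positivity)
    have hMg : 0 ≤ Mg := le_trans (Finset.sum_nonneg fun s _ => mul_nonneg (by positivity) (hg0 s)) (hmom ∅)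
    calc ∑ w ∈ S, |toReal w μ * toReal w ν * T w|
        ≤ ∑ w ∈ S, h (b + w) := Finset.sum_le_sum fun w _ => hdom w
      _ = ∑ u ∈ S', h u := by rw [hS', Finset.sum_map]; rfl
      _ ≤ ∑ u ∈ U m (S'.image (blk m)), h u := Finset.sum_le_sum_of_subset_of_nonneg (subset_U_image m S') fun u _ _ => hh0 u
      _ = ∑ β ∈ S'.image (blk m), ∑ u ∈ B m β, h u := sum_U _ _
      _ ≤ ∑ β ∈ S'.image (blk m), (((n : ℝ) - 1) * ((n : ℝ) ^ 4)⁻¹) *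
            ∑ s ∈ B m β, (2 * (PoissonInterior.supNorm (d := 4) (b - s) : ℝ) ^ 2 + 2 * (n : ℝ) ^ 2) * g s := Finset.sum_le_sum fun β _ => hblock β
      _ = (((n : ℝ) - 1) * ((n : ℝ) ^ 4)⁻¹) * ∑ s ∈ U m (S'.image (blk m)), (2 * (PoissonInterior.supNorm (d := 4) (b - s) : ℝ) ^ 2 + 2 * (n : ℝ) ^ 2) * g s := by
          rw [← Finset.mul_sum, sum_U]
      _ ≤ (((n : ℝ) - 1) * ((n : ℝ) ^ 4)⁻¹) * Mg := mul_le_mul_of_nonneg_left (hmom _) hmn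
  exact (abs_fullSum_le_of_abs_sum_le hfin).2

/-! ## §2 The (1.22) sum of T₅ at one base bond and the row at fixed `n` -/

/-- [folklore] **THE (1.22) SUM OF T₅ AT ONE BASE BOND** (root `ctrHalf n`): `|fullSum (w ↦ w_μw_ν·T₅(b+w,b))| ≤ (n−1)n⁻⁴·Mg(n)` with `Mg(n)` as in FILE R. -/
theorem abs_fullSum_T₅_le₁₀ (ha : 0 < a) (b : Pt) (μ ν : Fin 4) :
    |fullSum (fun w : Pt => toReal w μ * toReal w ν *
        biBubbleTable (Ggh n a) (Ggh n a) (qAntiAt (ctrHalf n) n) ghCur μ ν (b + w) b)|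
      ≤ (((n : ℝ) - 1) * ((n : ℝ) ^ 4)⁻¹) * (((n : ℝ) ^ 2)⁻¹ * (cNear a * (ghA1 a + 2 * (cG0 4 + cSplit 4 a)) * (2 * (2 * (Nat.factorial 2) * (2 / ghDelta a) ^ 2 * (1 + 2 * (4 : ℕ) * 3 ^ (4 - 1) * ((Nat.factorial (4 - 1 - 3)) * (4 / ghDelta a) ^ (4 - 1 - 3) * (1 + 4 / ghDelta a))) * (n : ℝ) ^ (4 - 3 + 2)) + 2 * (n : ℝ) ^ 2 * (2 * (Nat.factorial 0) * (2 / ghDelta a) ^ 0 * (1 + 2 * (4 : ℕ) * 3 ^ (4 - 1) * ((Nat.factorial (4 - 1 - 3)) * (4 / ghDelta a) ^ (4 - 1 - 3) * (1 + 4 / ghDelta a))) * (n : ℝ) ^ (4 - 3 + 0))) + cNear1 a / n * (ghA0 a + (cG0 4 + cSplit 4 a)) * (2 * (2 * (Nat.factorial 2) * (2 / ghDelta a) ^ 2 * (1 + 2 * (4 : ℕ) * 3 ^ (4 - 1) * ((Nat.factorial (4 - 1 - 2)) * (4 / ghDelta a) ^ (4 - 1 - 2) * (1 + 4 / ghDelta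 a))) * (n : ℝ) ^ (4 - 2 + 2)) + 2 * (n : ℝ) ^ 2 * (2 * (Nat.factorial 0) * (2 / ghDelta a) ^ 0 * (1 + 2 * (4 : ℕ) * 3 ^ (4 - 1) * ((Nat.factorial (4 - 1 - 2)) * (4 / ghDelta a) ^ (4 - 1 - 2) * (1 + 4 / ghDelta a))) * (n : ℝ) ^ (4 - 2 + 0))))) := by
  refine abs_fullSum_le_of_running_needle_envelope n (fun i => ctrHalf_mem n i) μ b
    (g := fun s => (((n : ℝ) ^ 2)⁻¹ * (cNear a * (ghA1 a + 2 * (cG0 4 + cSplit 4 a)) * (Real.exp (-(ghDelta a / n) * supNorm (b - s)) / nrm (b - s) ^ 3) + cNear1 a / n * (ghA0 a + (cG0 4 + cSplit 4 a)) * (Real.exp (-(ghDelta a / n) * supNorm (b - s)) / nrm (b - s) ^ 2)))) (fun s => env_nonneg n ha (b - s)) (fun w => ?_) (fun S => moment_env_le n ha b S) μ ν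
  exact abs_T₅_le_needle_env n ha (ctrHalf n) ν μ b (b + w)

/-- [folklore] **THE ROW BOUND AT FIXED `n`** (weight `ω` arbitrary): `|ω·Σ_b n⁻⁴·(n⁻⁸·fullSum_b)| ≤ |ω|·(n⁻⁸·((n−1)n⁻⁴·Mg(n)))` (base average trivial). -/
theorem abs_row₅_le₁₀ (ha : 0 < a) (ω : ℝ) (μ ν : Fin 4) :
    |ω * ∑ b ∈ (univ : Finset (Fin 4 → Fin n)).image resSite, ((n : ℝ) ^ 4)⁻¹ *
        (((n : ℝ) ^ 8)⁻¹ * fullSum (fun w : Pt => toReal w μ * toReal w ν *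
          biBubbleTable (Ggh n a) (Ggh n a) (qAntiAt (ctrHalf n) n) ghCur μ ν (b + w) b))|
      ≤ |ω| * (((n : ℝ) ^ 8)⁻¹ * ((((n : ℝ) - 1) * ((n : ℝ) ^ 4)⁻¹) * (((n : ℝ) ^ 2)⁻¹ * (cNear a * (ghA1 a + 2 * (cG0 4 + cSplit 4 a)) * (2 * (2 * (Nat.factorial 2) * (2 / ghDelta a) ^ 2 * (1 + 2 * (4 : ℕ) * 3 ^ (4 - 1) * ((Nat.factorial (4 - 1 - 3)) * (4 / ghDelta a) ^ (4 - 1 - 3) * (1 + 4 / ghDelta a))) * (n : ℝ) ^ (4 - 3 + 2)) + 2 * (n : ℝ) ^ 2 * (2 * (Nat.factorial 0) * (2 / ghDelta a) ^ 0 * (1 + 2 * (4 : ℕ) * 3 ^ (4 - 1) * ((Nat.factorial (4 - 1 - 3)) * (4 / ghDelta a) ^ (4 - 1 - 3) * (1 + 4 / ghDelta a))) * (n : ℝ) ^ (4 - 3 + 0))) + cNear1 a / n * (ghA0 a + (cG0 4 + cSplit 4 a)) * (2 * (2 * (Nat.factorial 2) * (2 / ghDelta a) ^ 2 * (1 + 2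 * (4 : ℕ) * 3 ^ (4 - 1) * ((Nat.factorial (4 - 1 - 2)) * (4 / ghDelta a) ^ (4 - 1 - 2) * (1 + 4 / ghDelta a))) * (n : ℝ) ^ (4 - 2 + 2)) + 2 * (n : ℝ) ^ 2 * (2 * (Nat.factorial 0) * (2 / ghDelta a) ^ 0 * (1 + 2 * (4 : ℕ) * 3 ^ (4 - 1) * ((Nat.factorial (4 - 1 - 2)) * (4 / ghDelta a) ^ (4 - 1 - 2) * (1 + 4 / ghDelta a))) * (n : ℝ) ^ (4 - 2 + 0))))))) := by
  have hn : (0 : ℝ) < n := by exact_mod_cast Nat.pos_of_ne_zero (NeZero.ne n)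
  have hn1 : (1 : ℝ) ≤ n := by exact_mod_cast NeZero.one_le
  set Mg := ((n : ℝ) ^ 2)⁻¹ * (cNear a * (ghA1 a + 2 * (cG0 4 + cSplit 4 a)) * (2 * (2 * (Nat.factorial 2) * (2 / ghDelta a) ^ 2 * (1 + 2 * (4 : ℕ) * 3 ^ (4 - 1) * ((Nat.factorial (4 - 1 - 3)) * (4 / ghDelta a) ^ (4 - 1 - 3) * (1 + 4 / ghDelta a))) * (n : ℝ) ^ (4 - 3 + 2)) + 2 * (n : ℝ) ^ 2 * (2 * (Nat.factorial 0) * (2 / ghDelta a) ^ 0 * (1 + 2 * (4 : ℕ) * 3 ^ (4 - 1) * ((Nat.factorial (4 - 1 - 3)) * (4 / ghDelta a) ^ (4 - 1 - 3) * (1 + 4 / ghDelta a))) * (n : ℝ) ^ (4 - 3 + 0))) + cNear1 a / n * (ghA0 a + (cG0 4 + cSplit 4 a)) * (2 * (2 * (Nat.factorial 2) * (2 / ghDelta a) ^ 2 * (1 + 2 * (4 : ℕ) * 3 ^ (4 - 1) * ((Nat.factorial (4 - 1 - 2)) * (4 / ghDelta a) ^ (4 - 1 - 2) * (1 + 4 /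 ghDelta a))) * (n : ℝ) ^ (4 - 2 + 2)) + 2 * (n : ℝ) ^ 2 * (2 * (Nat.factorial 0) * (2 / ghDelta a) ^ 0 * (1 + 2 * (4 : ℕ) * 3 ^ (4 - 1) * ((Nat.factorial (4 - 1 - 2)) * (4 / ghDelta a) ^ (4 - 1 - 2) * (1 + 4 / ghDelta a))) * (n : ℝ) ^ (4 - 2 + 0)))) with hMg
  have hMg0 : 0 ≤ Mg := le_trans (Finset.sum_nonneg fun w _ => mul_nonneg (by positivity) (env_nonneg n ha _)) (moment_env_le n ha 0 ∅)
  have hK : 0 ≤ ((n : ℝ) ^ 8)⁻¹ * ((((n : ℝ) - 1) * ((n : ℝ) ^ 4)⁻¹) * Mg) :=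
    mul_nonneg (by positivity) (mul_nonneg (mul_nonneg (sub_nonneg.2 hn1) (by positivity)) hMg0)
  have hb : ∀ b : Pt, |((n : ℝ) ^ 4)⁻¹ * (((n : ℝ) ^ 8)⁻¹ * fullSum (fun w : Pt => toReal w μ * toReal w ν *
      biBubbleTable (Ggh n a) (Ggh n a) (qAntiAt (ctrHalf n) n) ghCur μ ν (b + w) b))|
      ≤ ((n : ℝ) ^ 4)⁻¹ * (((n : ℝ) ^ 8)⁻¹ * ((((n : ℝ) - 1) * ((n : ℝ) ^ 4)⁻¹) * Mg)) := by
    intro b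
    rw [abs_mul, abs_mul, abs_of_nonneg (by positivity : (0 : ℝ) ≤ ((n : ℝ) ^ 4)⁻¹), abs_of_nonneg (by positivity : (0 : ℝ) ≤ ((n : ℝ) ^ 8)⁻¹)]
    exact mul_le_mul_of_nonneg_left (mul_le_mul_of_nonneg_left (abs_fullSum_T₅_le₁₀ n ha b μ ν) (by positivity)) (by positivity)
  rw [abs_mul]
  refine mul_le_mul_of_nonneg_left ?_ (abs_nonneg _)
  calc |∑ b ∈ (univ : Finset (Fin 4 → Fin n)).image resSite, ((n : ℝ) ^ 4)⁻¹ * (((n : ℝ) ^ 8)⁻¹ * fullSum (fun w : Pt => toReal w μ * toReal w ν *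
          biBubbleTable (Ggh n a) (Ggh n a) (qAntiAt (ctrHalf n) n) ghCur μ ν (b + w) b))|
      ≤ ∑ _b ∈ (univ : Finset (Fin 4 → Fin n)).image resSite, ((n : ℝ) ^ 4)⁻¹ * (((n : ℝ) ^ 8)⁻¹ * ((((n : ℝ) - 1) * ((n : ℝ) ^ 4)⁻¹) * Mg)) :=
        (Finset.abs_sum_le_sum_abs _ _).trans (Finset.sum_le_sum fun b _ => hb b)
    _ ≤ ((n : ℝ) ^ 8)⁻¹ * ((((n : ℝ) - 1) * ((n : ℝ) ^ 4)⁻¹) * Mg) := sum_resSite_avg_le hK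

/-! ## §3 «NT-5» with tolerance `n¹⁰`, in the glue's currency -/

variable {n} in
/-- [folklore] **«NT-5» WITH TOLERANCE `n¹⁰`**: `(ha : 0 < a) (hk : ∀ n ≥ 2, |ωgh n·(cQ n·cK n)| ≤ k·n¹⁰)` ⊢ the row `h₅` (`qA ⊗ ghCur` over `Ggh`) of
`NeedleRowGlue.abs_gN_row_le_of_tables` VERBATIM, with the same n-FREE constant `C₄(a)` as FILE R's `h₄_of_scaling₁₀` — four powers of `n` sharper than the record's
`h₅_of_scaling` (tolerance `n⁶`); met at the END-ii ray with `k := 4N²a`. -/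
theorem h₅_of_scaling₁₀ {k : ℝ} {cK cQ ωgh : ℕ → ℝ} (ha : 0 < a) (hk : ∀ n : ℕ, 2 ≤ n → |ωgh n * (cQ n * cK n)| ≤ k * (n : ℝ) ^ 10) (μ ν : Fin 4) :
    ∀ n : ℕ, 2 ≤ n → ∀ [NeZero n], |ωgh n * (cQ n * cK n) * ∑ b ∈ (univ : Finset (Fin 4 → Fin n)).image resSite, ((n : ℝ) ^ 4)⁻¹ *
      (((n : ℝ) ^ 8)⁻¹ * fullSum (fun w : Pt => toReal w μ * toReal w ν *
        biBubbleTable (Ggh n a) (Ggh n a) (qAntiAt (ctrHalf n) n) ghCur μ ν (b + w) b))|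
        ≤ k * (cNear a * (ghA1 a + 2 * (cG0 4 + cSplit 4 a)) * (2 * (2 * (Nat.factorial 2) * (2 / ghDelta a) ^ 2 * (1 + 2 * (4 : ℕ) * 3 ^ (4 - 1) * ((Nat.factorial (4 - 1 - 3)) * (4 / ghDelta a) ^ (4 - 1 - 3) * (1 + 4 / ghDelta a)))) + 2 * (2 * (Nat.factorial 0) * (2 / ghDelta a) ^ 0 * (1 + 2 * (4 : ℕ) * 3 ^ (4 - 1) * ((Nat.factorial (4 - 1 - 3)) * (4 / ghDelta a) ^ (4 - 1 - 3) * (1 + 4 / ghDelta a))))) + cNear1 a * (ghA0 a + (cG0 4 + cSplit 4 a)) * (2 * (2 * (Nat.factorial 2) * (2 / ghDelta a) ^ 2 * (1 + 2 * (4 : ℕ) * 3 ^ (4 - 1) * ((Nat.factorial (4 - 1 - 2)) * (4 / ghDelta a) ^ (4 - 1 - 2) * (1 + 4 / ghDelta a)))) + 2 * (2 * (Nat.factorial 0) * (2 / ghDelta a) ^ 0 * (1 + 2 * (4 : ℕ) * 3 ^ (4 - 1) * ((Nat.factorial (4 - 1 - 2)) * (4 / ghDelta a) ^ (4 - 1 -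 2) * (1 + 4 / ghDelta a)))))) := by
  intro n hn _
  have hn0 : (0 : ℝ) < n := by exact_mod_cast (show 0 < n by omega)
  have hrow := abs_row₅_le₁₀ n ha (ωgh n * (cQ n * cK n)) μ ν
  have hω := hk n hn
  have hkn : 0 ≤ k * (n : ℝ) ^ 10 := (abs_nonneg _).trans hω
  have e432 : (4 - 3 + 2 : ℕ) = 3 := rfl
  have e430 : (4 - 3 + 0 : ℕ) = 1 := rfl
  have e422 : (4 - 2 + 2 : ℕ) = 4 := rfl
  have e420 : (4 - 2 + 0 : ℕ) = 2 := rfl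
  rw [e432, e430, e422, e420, pow_one] at hrow
  have hδ := ghDelta_pos ha
  have hc1 := cNear_nonneg ha
  have hc2 := cNear1_nonneg ha
  have hA1 : 0 ≤ ghA1 a + 2 * (cG0 4 + cSplit 4 a) := by
    have := ghA1_nonneg ha; have := cG0_nonneg 4; have := cSplit_nonneg 4 ha; linarith
  have hA0 : 0 ≤ ghA0 a + (cG0 4 + cSplit 4 a) := by
    have := (ghA0_pos ha).le; have := cG0_nonneg 4; have := cSplit_nonneg 4 ha; linarith
  set A₁ := ghA1 a + 2 * (cG0 4 + cSplit 4 a) with hA₁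
  set A₀ := ghA0 a + (cG0 4 + cSplit 4 a) with hA₀
  set α₃ := 2 * (Nat.factorial 2) * (2 / ghDelta a) ^ 2 * (1 + 2 * (4 : ℕ) * 3 ^ (4 - 1) * ((Nat.factorial (4 - 1 - 3)) * (4 / ghDelta a) ^ (4 - 1 - 3) * (1 + 4 / ghDelta a))) with hα₃
  set β₃ := 2 * (Nat.factorial 0) * (2 / ghDelta a) ^ 0 * (1 + 2 * (4 : ℕ) * 3 ^ (4 - 1) * ((Nat.factorial (4 - 1 - 3)) * (4 / ghDelta a) ^ (4 - 1 - 3) * (1 + 4 / ghDelta a))) with hβ₃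
  set α₂ := 2 * (Nat.factorial 2) * (2 / ghDelta a) ^ 2 * (1 + 2 * (4 : ℕ) * 3 ^ (4 - 1) * ((Nat.factorial (4 - 1 - 2)) * (4 / ghDelta a) ^ (4 - 1 - 2) * (1 + 4 / ghDelta a))) with hα₂
  set β₂ := 2 * (Nat.factorial 0) * (2 / ghDelta a) ^ 0 * (1 + 2 * (4 : ℕ) * 3 ^ (4 - 1) * ((Nat.factorial (4 - 1 - 2)) * (4 / ghDelta a) ^ (4 - 1 - 2) * (1 + 4 / ghDelta a))) with hβ₂
  have hα₃0 : 0 ≤ α₃ := by rw [hα₃]; positivity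
  have hβ₃0 : 0 ≤ β₃ := by rw [hβ₃]; positivity
  have hα₂0 : 0 ≤ α₂ := by rw [hα₂]; positivity
  have hβ₂0 : 0 ≤ β₂ := by rw [hβ₂]; positivity
  clear_value A₁ A₀ α₃ β₃ α₂ β₂
  refine hrow.trans ?_
  have hn1 : (0 : ℝ) ≤ (n : ℝ) - 1 := by
    have : (2 : ℝ) ≤ n := by exact_mod_cast hn
    linarith
  have key : ((n : ℝ) ^ 8)⁻¹ * ((((n : ℝ) - 1) * ((n : ℝ) ^ 4)⁻¹) *
      (((n : ℝ) ^ 2)⁻¹ * (cNear a * A₁ * (2 * (α₃ * (n : ℝ) ^ 3) + 2 * (n : ℝ) ^ 2 * (β₃ * (n : ℝ)))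
        + cNear1 a / n * A₀ * (2 * (α₂ * (n : ℝ) ^ 4) + 2 * (n : ℝ) ^ 2 * (β₂ * (n : ℝ) ^ 2)))))
      ≤ ((n : ℝ) ^ 10)⁻¹ * (cNear a * A₁ * (2 * α₃ + 2 * β₃) + cNear1 a * A₀ * (2 * α₂ + 2 * β₂)) := by
    have e : ((n : ℝ) ^ 8)⁻¹ * ((((n : ℝ) - 1) * ((n : ℝ) ^ 4)⁻¹) *
        (((n : ℝ) ^ 2)⁻¹ * (cNear a * A₁ * (2 * (α₃ * (n : ℝ) ^ 3) + 2 * (n : ℝ) ^ 2 * (β₃ * (n : ℝ)))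
          + cNear1 a / n * A₀ * (2 * (α₂ * (n : ℝ) ^ 4) + 2 * (n : ℝ) ^ 2 * (β₂ * (n : ℝ) ^ 2)))))
        = (((n : ℝ) - 1) / n) * (((n : ℝ) ^ 10)⁻¹ * (cNear a * A₁ * (2 * α₃ + 2 * β₃) + cNear1 a * A₀ * (2 * α₂ + 2 * β₂))) := by
      field_simp
    rw [e]
    exact mul_le_of_le_one_left (by positivity) ((div_le_one hn0).2 (by linarith))
  have hbig : 0 ≤ ((n : ℝ) ^ 8)⁻¹ * ((((n : ℝ) - 1) * ((n : ℝ) ^ 4)⁻¹) *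
      (((n : ℝ) ^ 2)⁻¹ * (cNear a * A₁ * (2 * (α₃ * (n : ℝ) ^ 3) + 2 * (n : ℝ) ^ 2 * (β₃ * (n : ℝ)))
        + cNear1 a / n * A₀ * (2 * (α₂ * (n : ℝ) ^ 4) + 2 * (n : ℝ) ^ 2 * (β₂ * (n : ℝ) ^ 2))))) :=
    mul_nonneg (by positivity) (mul_nonneg (mul_nonneg hn1 (by positivity)) (by positivity))
  calc |ωgh n * (cQ n * cK n)| * (((n : ℝ) ^ 8)⁻¹ * ((((n : ℝ) - 1) * ((n : ℝ) ^ 4)⁻¹) *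
        (((n : ℝ) ^ 2)⁻¹ * (cNear a * A₁ * (2 * (α₃ * (n : ℝ) ^ 3) + 2 * (n : ℝ) ^ 2 * (β₃ * (n : ℝ)))
          + cNear1 a / n * A₀ * (2 * (α₂ * (n : ℝ) ^ 4) + 2 * (n : ℝ) ^ 2 * (β₂ * (n : ℝ) ^ 2))))))
      ≤ (k * (n : ℝ) ^ 10) * (((n : ℝ) ^ 10)⁻¹ * (cNear a * A₁ * (2 * α₃ + 2 * β₃) + cNear1 a * A₀ * (2 * α₂ + 2 * β₂))) :=
        mul_le_mul hω key hbig hkn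
    _ = k * (cNear a * A₁ * (2 * α₃ + 2 * β₃) + cNear1 a * A₀ * (2 * α₂ + 2 * β₂)) := by field_simp

end Summit.QuantumFields.BalabanUV.Beta.D1BFx.NeedleGhostBubbleRowMass10T5

end
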